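import Literature.Barriers.CriticalPhenomena.LongRangeTrivialityOnZ3Inputs

/-!
# The two-point-level inputs of Panis's bound on `S(β,L,f) = Σ_L⁻²∑|U₄|`: the tree diagram bound,
# the Messager–Miracle-Solé monotonicity, the sliding-scale infrared bound, the infrared bound for
# algebraically decaying reflection-positive couplings, and `χ_L ≤ C L^{-d} Σ_L`

Sibling of `Literature/Barriers/CriticalPhenomena/LongRangeTrivialityOnZ3.lean` (barrier catalogue
D-0021, sub-problem `Ising3DConformalLimit`). After `…Reduction`, `…Inputs` and `…Moments`, the barrier
`LongRangeTrivialityOnZ3` rests on two random-current/Lee–Yang moment facts and on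
`panis_ursellFourBoxSum_le` — the bound `S(β,L,f) ≤ C(β⁻⁴∨β⁻²) r_f^γ L^{-(d-2(α∧2))}` that page 22 of
Panis 2023 (arXiv:2309.05797) derives in the proof of Theorem 5.5. This file vendors, AS PRINTED and for
the algebraically decaying family `J_{x,y} = C₀|x-y|₁^{-d-α}` of Theorem 1.2 (which satisfies (A1)–(A5)),
the classical two-point-function results which that page combines, so that the derivation itself can be
formalised against them (the assembly is NOT in this file):

* `panis_treeDiagramBound` — the tree diagram bound of Aizenman 1982,
  `|U₄^β(x,y,z,t)| ≤ 2 ∑_{u∈ℤ^d} ⟨σ_xσ_u⟩_β⟨σ_yσ_u⟩_β⟨σ_zσ_u⟩_β⟨σ_tσ_u⟩_β` (§4.2, the display following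
  Proposition 4.7; §1.2.1), written with an `ℝ≥0∞`-valued sum over `ℤ^d` (no summability is asserted,
  exactly as printed);
* `panis_mms_two_point_monotone` — Corollary 3.3 (MMS2) of the Messager–Miracle-Solé inequalities
  (Proposition 3.2): `⟨σ₀σ_x⟩_β ≥ ⟨σ₀σ_y⟩_β` whenever `d|x|_∞ ≤ |y|_∞`;
* `panis_slidingScale_infraredBound` — Theorem 3.18 [ADC]: `χ_L(β)/L² ≤ (C/β) χ_ℓ(β)/ℓ²` for `β ≤ β_c`,
  `1 ≤ ℓ ≤ L` (`d ≥ 2`) — see the SCOPE CAVEATS in its docstring: the printed proof route does not cover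
  these couplings, and the barrier no longer uses it (`LongRangeTrivialityOnZ3NoSlidingScale.lean`);
* `panis_infraredBound_algebraic` — the last display of §3.6 (p. 16, from Proposition 3.8 and
  `1 - Ĵ(p) ≍ |p|^{α∧2}`): `⟨σ₀σ_x⟩_β ≤ C/(β_c|x|^{d-α∧2})` for `β ≤ β_c`, `x ≠ 0`, here for `α ≠ 2`
  (at `α = 2` the printed bound carries a logarithm) and `d ≥ 3` (Proposition 3.8; Remark 3.9 discusses
  `d ≤ 2`);
* `panis_boxSusceptibility_le_blockVariance` — the inequality `χ_L(β) ≤ C₂ L^{-d} Σ_L(β)` used (twice,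
  asserted there without proof) in the proof of Theorem 5.5, p. 22.

PROVED small print around the definitions of `…Inputs` (`pairCorrelation`, `boxSusceptibility`):
nonnegativity, symmetry, translation invariance, `⟨σ_xσ_x⟩ = 1`, `|⟨σ_xσ_y⟩| ≤ 1`, monotonicity of
`χ_L` in `L`, and `∑_{y∈Λ_{RL}} ⟨σ_uσ_y⟩ ≤ χ_{(d+1)RL}` for `u ∈ Λ_{dRL}` (the first step of the bound on
(1), p. 22).

## References

* R. Panis, arXiv:2309.05797 (2023) = Ann. Probab. 54 (2026): §1.2.1, §3.2 (Prop. 3.2, Cor. 3.3),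
  §3.3 (Prop. 3.8), §3.4 (Thm. 3.18), §3.6 (last display, p. 16), §4.2 (tree diagram bound), proof of
  Thm. 5.5 (p. 22) [Panis2023Triviality] (held; read pp. 13–16, 19–22).
* M. Aizenman, Comm. Math. Phys. 86 (1982); A. Messager, S. Miracle-Solé, J. Stat. Phys. 17 (1977);
  M. Aizenman, H. Duminil-Copin, Ann. Math. 194 (2021) — as cited there.
-/

noncomputable section

namespace Literature.Barriers.CriticalPhenomena

open Literature.Probability.LatticeModels Literature.Probability.Percolation Filter Topology Finset
open scoped symmDiff ENNReal

namespace LongRangeIsing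

variable {d : ℕ}

/-! ### Small print on the two-point function and `χ_L` -/

section TwoPointAPI

variable (J : Site d → Site d → ℝ) (β : ℝ)

/-- `⟨σ_xσ_y⟩ ≥ 0` (Griffiths I; `β ≥ 0`, `J ≥ 0`). [cite: Panis2023Triviality, §1.2.1 ((A1), Griffiths' inequalities)] -/
theorem pairCorrelation_nonneg (hβ : 0 ≤ β) (hJ : ∀ x y, 0 ≤ J x y) (x y : Site d) :
    0 ≤ pairCorrelation J β x y := by
  rw [pairCorrelation_eq]
  exact state_spinProduct_nonneg J β hβ hJ _

/-- `⟨σ_xσ_y⟩ = ⟨σ_yσ_x⟩`. [folklore] -/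
theorem pairCorrelation_comm (x y : Site d) : pairCorrelation J β x y = pairCorrelation J β y x := by
  rw [pairCorrelation_eq, pairCorrelation_eq, state_pair_comm]

/-- `⟨σ_xσ_x⟩ = 1`. [folklore] -/
theorem pairCorrelation_self (x : Site d) : pairCorrelation J β x x = 1 := by
  rw [pairCorrelation_eq, state_pair_self]

/-- Translation invariance `⟨σ_{x+a}σ_{y+a}⟩ = ⟨σ_xσ_y⟩` for translation-invariant `J ≥ 0`, `β ≥ 0`.
[cite: Panis2023Triviality, §1.2.1 ((A3) translation invariant)] -/
theorem pairCorrelation_add (hβ : 0 ≤ β) (hJ : ∀ x y, 0 ≤ J x y) (hJt : ∀ a x y, J (x + a) (y + a) = J x y)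
    (a x y : Site d) : pairCorrelation J β (x + a) (y + a) = pairCorrelation J β x y := by
  rw [pairCorrelation_eq, pairCorrelation_eq, state_pair_add J β hβ hJ hJt]

/-- `⟨σ₀σ_{y-x}⟩ = ⟨σ_xσ_y⟩` for translation-invariant `J ≥ 0`, `β ≥ 0`. [cite: Panis2023Triviality, §3 (S_{ρ,β}(x) := ⟨τ_0τ_x⟩)] -/
theorem pairCorrelation_zero_sub (hβ : 0 ≤ β) (hJ : ∀ x y, 0 ≤ J x y)
    (hJt : ∀ a x y, J (x + a) (y + a) = J x y) (x y : Site d) :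
    pairCorrelation J β 0 (y - x) = pairCorrelation J β x y := by
  rw [← pairCorrelation_add J β hβ hJ hJt x 0 (y - x), zero_add, sub_add_cancel]

/-- `|⟨σ_xσ_y⟩| ≤ 1` (`β ≥ 0`, `J ≥ 0`: a limit of averages of `±1`). [folklore] -/
theorem abs_pairCorrelation_le_one (hβ : 0 ≤ β) (hJ : ∀ x y, 0 ≤ J x y) (x y : Site d) :
    |pairCorrelation J β x y| ≤ 1 := by
  rw [pairCorrelation_eq]
  have h := tendsto_expectIn_box J β hβ hJ ({x} ∆ {y})
  refine abs_le.2 ⟨ge_of_tendsto' h fun L => ?_, le_of_tendsto' h fun L => ?_⟩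
  · exact (abs_le.1 (abs_expectIn_le_one J _ β 0 fun σ => abs_spinProduct_le_one _ σ)).1
  · exact (abs_le.1 (abs_expectIn_le_one J _ β 0 fun σ => abs_spinProduct_le_one _ σ)).2

/-- `χ_L(β) ≥ 0` (`β ≥ 0`, `J ≥ 0`). [folklore] -/
theorem boxSusceptibility_nonneg (hβ : 0 ≤ β) (hJ : ∀ x y, 0 ≤ J x y) (L : ℕ) : 0 ≤ boxSusceptibility J β L :=
  Finset.sum_nonneg fun x _ => pairCorrelation_nonneg J β hβ hJ 0 x

/-- `χ_L(β)` is nondecreasing in `L` (`β ≥ 0`, `J ≥ 0`). [folklore] -/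
theorem boxSusceptibility_mono (hβ : 0 ≤ β) (hJ : ∀ x y, 0 ≤ J x y) : Monotone (boxSusceptibility J β) :=
  fun _ _ h => Finset.sum_le_sum_of_subset_of_nonneg (box_mono d h) fun x _ _ => pairCorrelation_nonneg J β hβ hJ 0 x

/-- `1 ≤ χ_L(β)` (the term `x = 0`). [folklore] -/
theorem one_le_boxSusceptibility (hβ : 0 ≤ β) (hJ : ∀ x y, 0 ≤ J x y) (L : ℕ) : 1 ≤ boxSusceptibility J β L := by
  rw [boxSusceptibility, ← pairCorrelation_self J β (0 : Site d)]
  exact Finset.single_le_sum (f := fun x => pairCorrelation J β 0 x)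
    (fun x _ => pairCorrelation_nonneg J β hβ hJ 0 x) (zero_mem_box d L)

/-- **First step of the bound on (1), p. 22**: for `u ∈ Λ_{M}`,
`∑_{y ∈ Λ_{N}} ⟨σ_uσ_y⟩_β ≤ χ_{N+M}(β)` (translation invariance and `⟨σσ⟩ ≥ 0`; the source uses it with
`M = dr_fL`, `N = r_fL`, `N + M ≤ 2dr_fL`). [cite: Panis2023Triviality, proof of Theorem 5.5, bound on (1) ("∑_{y∈Λ_{r_fL}}⟨σ_xσ_y⟩_β ≤ χ_{2dr_fL}(β)"), p. 22] -/
theorem sum_box_pairCorrelation_le (hβ : 0 ≤ β) (hJ : ∀ x y, 0 ≤ J x y)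
    (hJt : ∀ a x y, J (x + a) (y + a) = J x y) {M N : ℕ} {u : Site d} (hu : u ∈ box d M) :
    ∑ y ∈ box d N, pairCorrelation J β u y ≤ boxSusceptibility J β (N + M) := by
  have h1 : ∑ y ∈ box d N, pairCorrelation J β u y = ∑ z ∈ (box d N).image (· - u), pairCorrelation J β 0 z := by
    rw [Finset.sum_image fun y _ y' _ h => sub_left_injective h]
    exact Finset.sum_congr rfl fun y _ => (pairCorrelation_zero_sub J β hβ hJ hJt u y).symm
  rw [h1, boxSusceptibility]
  refine Finset.sum_le_sum_of_subset_of_nonneg (fun z hz => ?_) fun z _ _ => pairCorrelation_nonneg J β hβ hJ 0 z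
  obtain ⟨y, hy, rfl⟩ := Finset.mem_image.1 hz
  rw [mem_box] at hy hu ⊢
  intro i
  obtain ⟨h1, h2⟩ := hy i
  obtain ⟨h3, h4⟩ := hu i
  simp only [Pi.sub_apply, Nat.cast_add]
  constructor <;> omega

end TwoPointAPI

end LongRangeIsing

open LongRangeIsing

/-! ### The printed two-point-level inputs (named facts), for `J_{x,y} = C₀|x-y|₁^{-d-α}` -/

/-- NAMED FACT — **the tree diagram bound (Aizenman 1982; Panis 2023, §4.2).** "Aizenman [A] argued the
case `d > 4` by using a first moment method on `|𝓘|` which yields the so-called tree diagram bound,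
`|U₄^β(x,y,z,t)| ≤ 2 ∑_{u∈ℤ^d} ⟨σ_xσ_u⟩_β ⟨σ_yσ_u⟩_β ⟨σ_zσ_u⟩_β ⟨σ_tσ_u⟩_β`" (also §1.2.1, p. 6), for `J`
satisfying (A1)–(A5); here for `J_{x,y} = C₀|x-y|₁^{-d-α}`, `C₀, α > 0`, and `0 < β ≤ β_c`. The sum over
`ℤ^d` is written in `ℝ≥0∞` (each term is `≥ 0` by Griffiths' first inequality), so that no summability
is asserted beyond what is printed. Relation to the tree: Aizenman's tree diagram bound is already
vendored for two other model formalisations — `Literature.Barriers.CriticalPhenomena.treeDiagramBound`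
(unit couplings on a finite simple graph) and `Literature.Probability.LatticeModels.aizenman_treeDiagramBound`
(the nearest-neighbour DLR state) — neither covering weighted long-range couplings; one printed theorem
per model. Users take `(h : panis_treeDiagramBound)`.
[cite: Panis2023Triviality, §4.2 (tree diagram bound, display following Proposition 4.7) and §1.2.1 (p. 6)] -/
def panis_treeDiagramBound : Prop :=
  ∀ (d : ℕ), 1 ≤ d → ∀ (C₀ α : ℝ), 0 < C₀ → 0 < α →
    ∀ (β : ℝ), 0 < β → β ≤ LongRangeIsing.criticalBeta (algebraicCoupling d C₀ α) →
      ∀ (x y z t : Site d),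
        ENNReal.ofReal |ursellFour (algebraicCoupling d C₀ α) β x y z t| ≤
          2 * ∑' u : Site d, ENNReal.ofReal
            (pairCorrelation (algebraicCoupling d C₀ α) β x u * pairCorrelation (algebraicCoupling d C₀ α) β y u *
              pairCorrelation (algebraicCoupling d C₀ α) β z u * pairCorrelation (algebraicCoupling d C₀ α) β t u)

/-- NAMED FACT — **Messager–Miracle-Solé monotonicity of the two-point function (Panis 2023,
Corollary 3.3, (MMS2)).** For a reflection-positive model with `J` satisfying (A1)–(A5), `d ≥ 1`,
`β > 0`: "for all `x, y ∈ ℤ^d` with `d|x| ≤ |y|`, `S_β(x) ≥ S_β(y)`", `S_β(x) = ⟨σ₀σ_x⟩_β`, `|·|` the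
supremum norm. Here for `J_{x,y} = C₀|x-y|₁^{-d-α}`, `C₀, α > 0`. Relation to the tree: the
nearest-neighbour MMS inequalities are the named facts `messager_miracleSole(_diag)` of
`Literature/Probability/LatticeModels/CorrelationInequalities.lean`, DISCHARGED in
`Literature/Probability/LatticeModels/MessagerMiracleSole.lean` (`messager_miracleSole_holds`,
`messager_miracleSole_diag_holds`); the reflection-positivity argument for general long-range couplings
(Proposition 3.2) is not in the tree. Users take
`(h : panis_mms_two_point_monotone)`. [cite: Panis2023Triviality, Corollary 3.3 (MMS2)] -/
def panis_mms_two_point_monotone : Prop :=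
  ∀ (d : ℕ), 1 ≤ d → ∀ (C₀ α : ℝ), 0 < C₀ → 0 < α → ∀ (β : ℝ), 0 < β →
    ∀ (x y : Site d), (d : ℝ) * ‖x‖ ≤ ‖y‖ →
      pairCorrelation (algebraicCoupling d C₀ α) β 0 y ≤ pairCorrelation (algebraicCoupling d C₀ α) β 0 x

/-- NAMED FACT — **the sliding-scale infrared bound (Aizenman–Duminil-Copin 2021; Panis 2023,
Theorem 3.18).** "Let `d ≥ 2`. There exists `C = C(d) > 0` such that for all `β ≤ β_c(ρ)` and
`1 ≤ ℓ ≤ L`, `χ_L(ρ,β)/L² ≤ (C/β) χ_ℓ(ρ,β)/ℓ²`", `χ_L(β) = ∑_{x∈Λ_L}⟨σ₀σ_x⟩_β`, for reflection-positive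
models with `J` satisfying (A1)–(A5); here for `J_{x,y} = C₀|x-y|₁^{-d-α}`, `C₀, α > 0`, `0 < β ≤ β_c`,
natural `1 ≤ ℓ ≤ L` (the constant may depend on `d, C₀, α`). Users take
`(h : panis_slidingScale_infraredBound)`.

SCOPE CAVEATS. (a) The quoted statement is that of arXiv v1 (2023), whose numbering the bib entry
pins; the published version (Ann. Probab. 54 (2026) = arXiv v2) states Theorem 3.18 for `d ≥ 1`, for
`β ≤ β_c(ρ)` with sharp length `L(ρ,β) ≥ 3`, and with a constant `C` in place of `C/β`. (b) The printed
proof ("the proof follows the exact same lines as in [ADC]" once Corollary 3.17 is available) goes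
through Proposition 3.16, whose Appendix proof invokes reflection positivity with respect to the
DIAGONAL hyperplane orthogonal to `e₁ + e₂`; for the couplings `C₀|x-y|₁^{-d-α}` vendored here the
coupling matrix across that mirror is not positive semidefinite
(`LongRangeIsing.algebraicCoupling_diag_not_posSemidef` in `LongRangeTrivialityOnZ3NoSlidingScale.lean`,
`d = 2`, `α = 1`), so the standard route to reflection positivity of pair interactions
(Friedli–Velenik 2017, Lemma 10.8) is unavailable there and the printed argument does not cover this
family as it stands (coordinate mirrors, hence Corollary 3.15, Proposition 3.8 and the MMS inequalities,
are unaffected). Nothing asserts that the inequality fails. (c) The barrier `LongRangeTrivialityOnZ3` no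
longer depends on this fact: `LongRangeTrivialityOnZ3.of_fourFacts` (in that file) replaces both uses of
Theorem 3.18 on p. 22 by the Messager–Miracle-Solé comparison `χ_m ≤ (1+(3d)^d)(m/ℓ)^dχ_ℓ`; and
`panis_slidingScale_infraredBound_of_subcritical` (`LongRangeTrivialityOnZ3LeftContinuity.lean`) reduces
this fact to its case `β < β_c`. [cite: Panis2023Triviality, Theorem 3.18] -/
def panis_slidingScale_infraredBound : Prop :=
  ∀ (d : ℕ), 2 ≤ d → ∀ (C₀ α : ℝ), 0 < C₀ → 0 < α →
    ∃ C : ℝ, 0 < C ∧ ∀ (β : ℝ), 0 < β → β ≤ LongRangeIsing.criticalBeta (algebraicCoupling d C₀ α) →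
      ∀ (ℓ L : ℕ), 1 ≤ ℓ → ℓ ≤ L →
        boxSusceptibility (algebraicCoupling d C₀ α) β L / (L : ℝ) ^ 2 ≤
          C / β * (boxSusceptibility (algebraicCoupling d C₀ α) β ℓ / (ℓ : ℝ) ^ 2)

/-- NAMED FACT — **the infrared bound for algebraically decaying reflection-positive couplings (Panis
2023, §3.6, last display of p. 16, from Proposition 3.8).** "Using Proposition 3.8 we get that
reflection positive interactions satisfying the above assumption [`c₀k^{-1-α} ≤ ∑_{|x|=k}J_{0,x} ≤ C₀k^{-1-α}`]
also satisfy: there exists `C = C(d) > 0` such that for all `β ≤ β_c(ρ)`, for all `x ∈ ℤ^d ∖ {0}`,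
`⟨τ₀τ_x⟩_{ρ,β} ≤ (C/β_c(ρ)) |x|^{-(d-α∧2)} (log|x|)^{δ_{α,2}}`", "the prototypical example … is given by
algebraically decaying RP interactions"; Proposition 3.8 is stated for `d ≥ 3`. Vendored for
`J_{x,y} = C₀|x-y|₁^{-d-α}` with `α ≠ 2` (no logarithm), `d ≥ 3`, `0 < β ≤ β_c`, the constant absorbing
`1/β_c` (it may depend on `d, C₀, α`); `|x|` is the supremum norm. Users take
`(h : panis_infraredBound_algebraic)`. [cite: Panis2023Triviality, §3.6, last display of p. 16 (with Proposition 3.8 and Remark 3.9)] -/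
def panis_infraredBound_algebraic : Prop :=
  ∀ (d : ℕ), 3 ≤ d → ∀ (C₀ α : ℝ), 0 < C₀ → 0 < α → α ≠ 2 →
    ∃ C : ℝ, 0 < C ∧ ∀ (β : ℝ), 0 < β → β ≤ LongRangeIsing.criticalBeta (algebraicCoupling d C₀ α) →
      ∀ (x : Site d), x ≠ 0 →
        pairCorrelation (algebraicCoupling d C₀ α) β 0 x ≤ C / ‖x‖ ^ ((d : ℝ) - min α 2)

/-- NAMED FACT — **`χ_L(β) ≤ C₂ L^{-d} Σ_L(β)` (Panis 2023, proof of Theorem 5.5, p. 22)**: "using that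
`χ_L(β) ≤ C₂L^{-d}Σ_L(β)`" (for `β ≤ β_c`, `L ≥ 1`; asserted there without proof), here for `J_{x,y} = C₀|x-y|₁^{-d-α}`, `C₀, α > 0`, `0 < β ≤ β_c`.
Users take `(h : panis_boxSusceptibility_le_blockVariance)`.
[cite: Panis2023Triviality, proof of Theorem 5.5, bound on (1) ("χ_L(β) ≤ C₂L^{-d}Σ_L(β)"), p. 22] -/
def panis_boxSusceptibility_le_blockVariance : Prop :=
  ∀ (d : ℕ), 1 ≤ d → ∀ (C₀ α : ℝ), 0 < C₀ → 0 < α →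
    ∃ C₂ : ℝ, 0 < C₂ ∧ ∀ (β : ℝ), 0 < β → β ≤ LongRangeIsing.criticalBeta (algebraicCoupling d C₀ α) →
      ∀ (L : ℕ), 1 ≤ L →
        boxSusceptibility (algebraicCoupling d C₀ α) β L ≤
          C₂ * ((L : ℝ) ^ d)⁻¹ * blockVariance (algebraicCoupling d C₀ α) β L

end Literature.Barriers.CriticalPhenomena

end
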